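import Summits.ABC.ABC.Theorems.IUTThetaPilotThetaPartIIDisplay
import Summits.ABC.ABC.Theorems.IUTThetaPilotThetaPartIIStubThetaData
import Summits.ABC.ABC.Theorems.IUTThetaPilotThetaPartIIStubThetaDataPrelims
import Summits.ABC.IUTFork.LDHGenuineTowerArithEmod
import Summits.ABC.IUTFork.LDHGenuinePoint
import HarnessLib

/-!
# [IUTchIV] Theorem 1.10's display VERBATIM — with print's `e*_mod`, not the `d*_mod` weakening — at every admissible
# point of the `λ`-line, modulo [IUTchIII] Cor. 3.12 at the Θ-data alone (reading (P)) / + an e-form regime binder (reading (U))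

Mochizuki, *Inter-universal Teichmüller theory IV*, RIMS manuscript (Apr. 2020; = PRIMS **57** (2021)), Thm. 1.10, p. 22
("`(1 ≤) e_mod (≤ d_mod)` for the maximal ramification index of `F_mod` over `ℚ`", "`e*_mod := 2^12·3^3·5·e_mod (≤ d*_mod)`")
and p. 23, the displayed conclusion:

  `(1/6)·log(q) ≤ (1 + 20·d_mod/l)·(log(𝔡^{F_tpd}) + log(𝔣^{F_tpd})) + 20·(e*_mod·l + η_prm)`.

Record-only, proof-only file (D-0012) of the abc-iut cell (campaign-S seat abc-iut-S3); TAKES NO SIDE on [IUTchIII] Cor. 3.12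
or on the reading (U)/(P) of `−|log(Θ)|`. The cell's chain to `ABC` consumes Thm. 1.10 in the form [IUTchIV] Cor. 2.2 applies
it (p. 46 l. 1), with `d*_mod` in place of `e*_mod` (`Cor22.Display`; abc-iut-S1's (R4) and abc-iut-S3's `B_III` junctions set
`e_mod := d_mod`, admissible since `e_mod ≤ d_mod`) — a WEAKER inequality than the one printed in Thm. 1.10. THIS FILE closes
that faithfulness gap: for EVERY natural number `e` with `1 ≤ e ≤ d_mod` bounding the ramification indices over `ℚ` of the
finite places of `F_mod = ℚ(j(λ))` — print's `e_mod` is the least such `e`, so the statements below at `e = e_mod` are print's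
display literally — it proves

* `ThetaPartIIDisplay.displayE_of_squeezeE` — Step (viii) at a point with the constant
  `B^e_III(P,l) = (l+1)/4·{(1+12·d_mod/l)·(log 𝔡 + log 𝔣) + 2·log l + 52 + (20/3)·log(e*·l)·π(e*·l)}`: the squeeze
  `((l+1)/24 − 1/(2l))·log q ≤ B^e_III + ((l+5)/4)·log π` ⟹ the display with `20·(e*·l + η_prm)` (abc-iut-S-d2's
  `display_of_squeezeIII` verbatim with `emod := e` in abc-iut-S3's `Thm110Numerics` — `C_Θ ≥ −1` ⟹ display, p. 23, pp. 30–31);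
* **`thm110DisplayVerbatim_of_cor312PerImage`** — reading (P): from `stub_cor312PerImage` ALONE ([IUTchIII] Cor. 3.12 read per
  image at every genuine Θ-volume datum, abc-iut-S7; disputed claim), print's display at every admissible `(P, l)` and every
  admissible `e` — the volume side being abc-iut-S3's `PointDict.hullVolumePerImageAtDatum_BIIIe` (NO hypothesis: (R4) with
  `e_mod` = `R4_towerFact_emod`, tower arithmetic, abc-iut-S7's per-image Step (v)), the datum abc-iut-L5-t7's `stub_thetaData`;
* **`thm110DisplayVerbatim_of_cor312_of_hullRegimeE`** — reading (U): from `stub_cor312` and the e-form regime binder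
  (the (U)-hull estimate with `B^e_III` at the non-slot-constant data; slot-constant data by `hullEstimateOf_BIIIe_pinned`).
So the node [IUTchIV] Thm. 1.10 is, on the `λ`-line, kernel-reduced to the disputed Corollary EXACTLY AS PRINTED (constant
`e*_mod`), not only in its `d*_mod` weakening. CONDITIONAL theorems; nothing asserted; no side taken.
[cite: Mochizuki2012, IUTchIV Thm. 1.10 pp. 22–31] [claim: Mochizuki2012, status: disputed] for every IUT quotation.
-/

noncomputable section

set_option linter.dupNamespace false

namespace Summit.ABC.ABC.Theorems.ThetaPartIIDisplay

open Literature.IUT.LogVolume Literature.NumberTheory.DiophantineGeometry.GenEll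
open NumberField IsDedekindDomain

/-! ## Step (viii) at a point with the constant `B^e_III` -/

/-- **Step (viii) at a point, constant `B^e_III` (print's `e*_mod`)**: for `l ≥ 5` prime, `l ≠ 5`, `IsEtaPrm η_prm`, and
`1 ≤ e ≤ d_mod`: the squeeze `((l+1)/24 − 1/(2l))·log(q^{∤{2,l}}) ≤ B^e_III(P,l) + ((l+5)/4)·log π` implies PRINT'S display
`(1/6)·log(q) ≤ (1 + 20·d_mod/l)·(log 𝔡 + log 𝔣) + 20·(e*·l + η_prm)`, `e* = 2^12·3^3·5·e`. abc-iut-S-d2's `display_of_squeezeIII`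
verbatim with `emod := e` in the numerics record: Step (vii) `(l+5)/4·log π ≤ (l+1)/4·4`, Prop. 1.6 `log(e*·l)·π(e*·l) ≤
(4/3)·(e*·l + η_prm)` (`log_mul_primeCounting_le_of_isEtaPrm`, PROVED), `2·log l + 56 ≤ (1/3)·(4/3)·(e*·l + η_prm)`
(abc-iut-S3 `Thm110Numerics.stepviii_absorb`), braces of `C_Θ` `≥ 0`, `C_Θ ≥ −1`, `Thm110Numerics.display_of_neg_one_le_CTheta`.
Pure arithmetic; no side taken. [cite: Mochizuki2012, IUTchIV Thm. 1.10 p. 23, proof Steps (vii)–(viii) p. 30–31]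
[claim: Mochizuki2012, status: disputed] -/
theorem displayE_of_squeezeE {P : NFPoint} {l : ℕ} (hl : l.Prime) (h5 : 5 ≤ l) (hne : l ≠ 5) {η : ℝ}
    (hη : IsEtaPrm η) {e : ℕ} (he : 1 ≤ e) (he' : e ≤ Cor22.dmod P)
    (hineq : (((l : ℝ) + 1) / 24 - 1 / (2 * l)) * Cor22.logQAvoid P {2, l} ≤
      ((l : ℝ) + 1) / 4 *
          ((1 + 12 * (Cor22.dmod P : ℝ) / l) * (P.logDiff + Cor22.logCondAvoid P {2, l})
            + 2 * Real.log l + 52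
            + 20 / 3 * Real.log (((2 ^ 12 * 3 ^ 3 * 5 * e : ℕ) : ℝ) * (l : ℝ))
              * (Nat.primeCounting (2 ^ 12 * 3 ^ 3 * 5 * e * l) : ℝ))
        + ThetaVolumeInput.archLogTheta l) :
    1 / 6 * Cor22.logQAvoid P {2, l} ≤
      (1 + 20 * (Cor22.dmod P : ℝ) / l) * (P.logDiff + Cor22.logCondAvoid P {2, l})
        + 20 * ((((2 ^ 12 * 3 ^ 3 * 5 * e : ℕ) : ℝ)) * l + η) := by
  have hLD : 0 ≤ P.logDiff := P.logDiff_nonneg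
  have hLC : 0 ≤ Cor22.logCondAvoid P {2, l} := Cor22.logCondAvoid_nonneg P {2, l}
  have hl1 : (1 : ℝ) ≤ l := by exact_mod_cast hl.one_lt.le
  have hl0 : (0 : ℝ) < l := by linarith
  have hd1 : (1 : ℝ) ≤ (Cor22.dmod P : ℝ) := by exact_mod_cast Cor22.dmod_pos P
  have hη0 : 0 < η := hη.1
  by_cases hq : 0 < Cor22.logQAvoid P {2, l}
  swap
  · -- `log(q) ≤ 0`: the display is trivial (its right-hand side is nonnegative)
    have hq' : Cor22.logQAvoid P {2, l} ≤ 0 := not_lt.1 hq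
    have h1 : 0 ≤ (1 + 20 * (Cor22.dmod P : ℝ) / l) * (P.logDiff + Cor22.logCondAvoid P {2, l}) := by
      positivity
    have h2 : 0 ≤ 20 * ((((2 ^ 12 * 3 ^ 3 * 5 * e : ℕ) : ℝ)) * l + η) := by positivity
    have h3 : 1 / 6 * Cor22.logQAvoid P {2, l} ≤ 0 := by linarith
    exact h3.trans (add_nonneg h1 h2)
  -- the numerics of the point, with `−|log(Θ)| := −|log(q)|` and `e_mod := e`
  let X : Thm110Numerics :=
    { l := l, prime_l := hl, five_le_l := h5
      dmod := Cor22.dmod P, one_le_dmod := Cor22.dmod_pos P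
      emod := e, one_le_emod := he, emod_le_dmod := he'
      etaPrm := η, etaPrm_pos := hη.1
      logDiffTpd := P.logDiff, logDiffTpd_nonneg := hLD
      logCondTpd := Cor22.logCondAvoid P {2, l}, logCondTpd_nonneg := hLC
      logDiffF := P.logDiff, logDiffF_nonneg := hLD
      logCondF := Cor22.logCondAvoid P {2, l}, logCondF_nonneg := hLC
      logq := Cor22.logQAvoid P {2, l}, logq_pos := hq
      negLogTheta := -(Cor22.logQAvoid P {2, l} / (2 * (l : ℝ))) }
  have h7 : 7 ≤ X.l := X.seven_le_l_of_ne_five hne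
  -- Prop. 1.6 (the prime number theorem, proved in the tree): `log(e*·l)·π(e*·l) ≤ (4/3)·(e*·l + η)`
  have hpnt : Real.log (((2 ^ 12 * 3 ^ 3 * 5 * e : ℕ) : ℝ) * (l : ℝ))
      * (Nat.primeCounting (2 ^ 12 * 3 ^ 3 * 5 * e * l) : ℝ) ≤
      4 / 3 * ((((2 ^ 12 * 3 ^ 3 * 5 * e : ℕ) : ℝ)) * l + η) := by
    have h0 : (0 : ℝ) ≤ (((2 ^ 12 * 3 ^ 3 * 5 * e : ℕ) : ℝ)) * l := by positivity
    have h2 := log_mul_primeCounting_le_of_isEtaPrm hη h0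
    rwa [show ⌊(((2 ^ 12 * 3 ^ 3 * 5 * e : ℕ) : ℝ)) * (l : ℝ)⌋₊ = 2 ^ 12 * 3 ^ 3 * 5 * e * l by
      exact_mod_cast Nat.floor_natCast (2 ^ 12 * 3 ^ 3 * 5 * e * l)] at h2
  -- Step (viii): `2·log l + 56 ≤ (1/3)·(4/3)·(e*·l + η)` (abc-iut-S3's `stepviii_absorb`)
  have habs : 2 * Real.log (l : ℝ) + 56 ≤
      1 / 3 * (4 / 3) * ((((2 ^ 12 * 3 ^ 3 * 5 * e : ℕ) : ℝ)) * l + η) :=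
    Thm110Numerics.stepviii_absorb X
  -- Step (vii): `(l+5)/4·log π ≤ (l+1)/4·4`
  have harch : ThetaVolumeInput.archLogTheta l ≤ ((l : ℝ) + 1) / 4 * 4 := by
    unfold ThetaVolumeInput.archLogTheta
    have hpi := log_pi_le_two
    have hl5 : (5 : ℝ) ≤ l := by exact_mod_cast h5
    have h1 : ((l : ℝ) + 5) / 4 * Real.log Real.pi ≤ ((l : ℝ) + 5) / 4 * 2 :=
      mul_le_mul_of_nonneg_left hpi (by positivity)
    linarith
  -- the braces of `C_Θ` are nonnegative
  have hbr : 0 ≤ X.bracket := by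
    show 0 ≤ (1 + 12 * (Cor22.dmod P : ℝ) / l) * (P.logDiff + Cor22.logCondAvoid P {2, l})
      + 10 * ((((2 ^ 12 * 3 ^ 3 * 5 * e : ℕ) : ℝ)) * l + η)
      - 1 / 6 * (1 - 12 / ((l : ℝ) ^ 2)) * Cor22.logQAvoid P {2, l}
    have hc : (0 : ℝ) < ((l : ℝ) + 1) / 4 := by positivity
    -- hypothesis + Step (vii)
    have h1 : (((l : ℝ) + 1) / 24 - 1 / (2 * l)) * Cor22.logQAvoid P {2, l} ≤
        ((l : ℝ) + 1) / 4 *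
          ((1 + 12 * (Cor22.dmod P : ℝ) / l) * (P.logDiff + Cor22.logCondAvoid P {2, l})
            + 2 * Real.log l + 52
            + 20 / 3 * Real.log (((2 ^ 12 * 3 ^ 3 * 5 * e : ℕ) : ℝ) * (l : ℝ))
              * (Nat.primeCounting (2 ^ 12 * 3 ^ 3 * 5 * e * l) : ℝ) + 4) := by
      have eq : ((l : ℝ) + 1) / 4 *
          ((1 + 12 * (Cor22.dmod P : ℝ) / l) * (P.logDiff + Cor22.logCondAvoid P {2, l})
            + 2 * Real.log l + 52
            + 20 / 3 * Real.log (((2 ^ 12 * 3 ^ 3 * 5 * e : ℕ) : ℝ) * (l : ℝ))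
              * (Nat.primeCounting (2 ^ 12 * 3 ^ 3 * 5 * e * l) : ℝ) + 4) =
          ((l : ℝ) + 1) / 4 *
          ((1 + 12 * (Cor22.dmod P : ℝ) / l) * (P.logDiff + Cor22.logCondAvoid P {2, l})
            + 2 * Real.log l + 52
            + 20 / 3 * Real.log (((2 ^ 12 * 3 ^ 3 * 5 * e : ℕ) : ℝ) * (l : ℝ))
              * (Nat.primeCounting (2 ^ 12 * 3 ^ 3 * 5 * e * l) : ℝ))
          + ((l : ℝ) + 1) / 4 * 4 := by ring
      rw [eq]
      linarith
    -- `(l+1)/4·(1/6)·(1 − 12/l²) ≤ (l+1)/24 − 1/(2l)`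
    have hcoef : ((l : ℝ) + 1) / 4 * (1 / 6 * (1 - 12 / ((l : ℝ) ^ 2))) ≤
        ((l : ℝ) + 1) / 24 - 1 / (2 * l) := by
      have hdiff : ((l : ℝ) + 1) / 24 - 1 / (2 * l) - ((l : ℝ) + 1) / 4 * (1 / 6 * (1 - 12 / ((l : ℝ) ^ 2)))
          = 1 / (2 * (l : ℝ) ^ 2) := by
        field_simp
        ring
      have hpos : (0 : ℝ) ≤ 1 / (2 * (l : ℝ) ^ 2) := by positivity
      linarith
    have h2 : ((l : ℝ) + 1) / 4 * (1 / 6 * (1 - 12 / ((l : ℝ) ^ 2)) * Cor22.logQAvoid P {2, l}) ≤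
        (((l : ℝ) + 1) / 24 - 1 / (2 * l)) * Cor22.logQAvoid P {2, l} := by
      calc ((l : ℝ) + 1) / 4 * (1 / 6 * (1 - 12 / ((l : ℝ) ^ 2)) * Cor22.logQAvoid P {2, l})
          = ((l : ℝ) + 1) / 4 * (1 / 6 * (1 - 12 / ((l : ℝ) ^ 2))) * Cor22.logQAvoid P {2, l} := by ring
        _ ≤ (((l : ℝ) + 1) / 24 - 1 / (2 * l)) * Cor22.logQAvoid P {2, l} :=
          mul_le_mul_of_nonneg_right hcoef hq.le
    have h3 : 1 / 6 * (1 - 12 / ((l : ℝ) ^ 2)) * Cor22.logQAvoid P {2, l} ≤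
        (1 + 12 * (Cor22.dmod P : ℝ) / l) * (P.logDiff + Cor22.logCondAvoid P {2, l})
          + 2 * Real.log l + 52
          + 20 / 3 * Real.log (((2 ^ 12 * 3 ^ 3 * 5 * e : ℕ) : ℝ) * (l : ℝ))
            * (Nat.primeCounting (2 ^ 12 * 3 ^ 3 * 5 * e * l) : ℝ) + 4 :=
      le_of_mul_le_mul_left (le_trans h2 h1) hc
    have hE : (0 : ℝ) ≤ (((2 ^ 12 * 3 ^ 3 * 5 * e : ℕ) : ℝ)) * l + η := by positivity
    have hpnt' : 20 / 3 * Real.log (((2 ^ 12 * 3 ^ 3 * 5 * e : ℕ) : ℝ) * (l : ℝ))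
        * (Nat.primeCounting (2 ^ 12 * 3 ^ 3 * 5 * e * l) : ℝ) ≤
        20 / 3 * (4 / 3 * ((((2 ^ 12 * 3 ^ 3 * 5 * e : ℕ) : ℝ)) * l + η)) := by
      rw [mul_assoc]
      exact mul_le_mul_of_nonneg_left hpnt (by norm_num)
    -- name the (nonlinear) atoms so that the final step is visibly linear
    set W : ℝ := 20 / 3 * Real.log (((2 ^ 12 * 3 ^ 3 * 5 * e : ℕ) : ℝ) * (l : ℝ))
        * (Nat.primeCounting (2 ^ 12 * 3 ^ 3 * 5 * e * l) : ℝ) with hW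
    set E : ℝ := (((2 ^ 12 * 3 ^ 3 * 5 * e : ℕ) : ℝ)) * l + η with hEdef
    set A : ℝ := (1 + 12 * (Cor22.dmod P : ℝ) / l) * (P.logDiff + Cor22.logCondAvoid P {2, l}) with hA
    set Q : ℝ := 1 / 6 * (1 - 12 / ((l : ℝ) ^ 2)) * Cor22.logQAvoid P {2, l} with hQ
    set G : ℝ := Real.log (l : ℝ) with hG
    linarith [hpnt', habs, h3, hE]
  -- `C_Θ ≥ −1`
  have hC : -1 ≤ X.CTheta := by
    unfold Thm110Numerics.CTheta
    have hq' := X.absLogq_pos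
    have hl5 := X.five_le_l_real
    have : 0 ≤ ((X.l : ℝ) + 1) / (4 * X.absLogq) * X.bracket := mul_nonneg (by positivity) hbr
    linarith
  -- the last paragraph of the proof of Thm. 1.10: `C_Θ ≥ −1` ⟹ the display, WITH `e*_mod = 2^12·3^3·5·e`
  have hfin := Thm110Numerics.display_of_neg_one_le_CTheta h7 hC
  exact hfin

end Summit.ABC.ABC.Theorems.ThetaPartIIDisplay

/-! ## The display verbatim at every admissible point, modulo [IUTchIII] Cor. 3.12 at the Θ-data -/

namespace Summit.ABC.ABC.Theorems.ThetaPartII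

open Literature.NumberTheory.DiophantineGeometry.GenEll Literature.IUT.LogVolume Literature.IUT.HodgeTheaters
open Summit.ABC.IUTFork NumberField IsDedekindDomain Literature.NumberTheory.NumberFields

/-- **[IUTchIV] Thm. 1.10's display VERBATIM (constant `20·(e*_mod·l + η_prm)`) at every admissible point of the `λ`-line,
reading (P), from `stub_cor312PerImage` ALONE**: IF [IUTchIII] Cor. 3.12 read per image holds at every genuine Θ-volume datum of
every admissible `(P, l)` (abc-iut-S7's `Cor22.Cor312PerImageAtDatum`, registered stub — the disputed claim), THEN for every
`η_prm` with `IsEtaPrm`, every `P ∈ UP`, prime `l ≥ 5` with `AdmitsCore`, (P2), (P5), (P6), and every `e` with `1 ≤ e ≤ d_mod`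
bounding the ramification indices over `ℚ` of the finite places of `F_mod = ℚ(j(λ))` (print's `e_mod` is the least such `e`):
`(1/6)·log(q^{∤{2,l}}(λ)) ≤ (1 + 20·d_mod/l)·(log-diff + log 𝔣^{∤{2,l}}) + 20·((2^12·3^3·5·e)·l + η_prm)`. Volume side a THEOREM
(abc-iut-S3 `PointDict.hullVolumePerImageAtDatum_BIIIe`: (R4) with `e_mod`, tower arithmetic, abc-iut-S7's per-image Step (v));
the datum from abc-iut-L5-t7's `stub_thetaData`; squeeze `Cor22.gap_le_at_perImage` + `PointDict.gap_eq`; `l ≥ 7` from (P6).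
CONDITIONAL on `h312P` only; nothing asserted; no side taken. [cite: Mochizuki2012, IUTchIV Thm. 1.10 p. 22–23]
[claim: Mochizuki2012, status: disputed] -/
theorem thm110DisplayVerbatim_of_cor312PerImage
    (h312P : ∀ P : NFPoint, P ∈ UP → ∀ l : ℕ, l.Prime → 5 ≤ l →
      Cor22.AdmitsCore P → Cor22.CondP2 P l → Cor22.CondP5 P l → Cor22.CondP6 P l →
        Cor22.Cor312PerImageAtDatum P l)
    {η : ℝ} (hη : IsEtaPrm η) {P : NFPoint} (hP : P ∈ UP) {l : ℕ} (hl : l.Prime) (h5 : 5 ≤ l)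
    (hcore : Cor22.AdmitsCore P) (h2 : Cor22.CondP2 P l) (hP5 : Cor22.CondP5 P l) (h6 : Cor22.CondP6 P l)
    {e : ℕ} (he : 1 ≤ e) (he' : e ≤ Cor22.dmod P)
    (hemod : ∀ w : HeightOneSpectrum (𝓞 (IntermediateField.adjoin ℚ ({Cor22.jInv P.x} : Set P.F))),
      w.asIdeal.ramificationIdx ℤ ≤ e) :
    1 / 6 * Cor22.logQAvoid P {2, l} ≤
      (1 + 20 * (Cor22.dmod P : ℝ) / l) * (P.logDiff + Cor22.logCondAvoid P {2, l})
        + 20 * ((((2 ^ 12 * 3 ^ 3 * 5 * e : ℕ) : ℝ)) * l + η) := by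
  have h7 : 7 ≤ l := seven_le_of_condP6 hP hl h5 h6
  have hne : l ≠ 5 := by omega
  obtain ⟨T⟩ := Summit.ABC.ABC.Theorems.ThetaPartII.stub_thetaData P hP l hl h5 hcore h2 hP5 h6
  refine ThetaPartIIDisplay.displayE_of_squeezeE hl h5 hne hη he he' ?_
  rw [← PointDict.gap_eq T hP.1]
  exact Cor22.gap_le_at_perImage (h312P P hP l hl h5 hcore h2 hP5 h6)
    (PointDict.hullVolumePerImageAtDatum_BIIIe hP h7 he hemod) T

/-- **[IUTchIV] Thm. 1.10's display VERBATIM at every admissible point of the `λ`-line, reading (U), from `stub_cor312` and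
the e-form regime binder**: IF [IUTchIII] Cor. 3.12 (hull of the union, print's number) holds at every genuine Θ-volume datum of
every admissible `(P, l)` (`Cor22.Cor312AtDatum`, registered stub `stub_cor312` — the disputed claim) AND, at the admissible
`(P, l)` in question, the (U)-hull estimate with `B^e_III(P,l)` holds for the NON-slot-constant genuine data (`hregE` — plan
VERDICT RISK ¶7's locus, in its `e_mod`-form), THEN print's display holds there for every admissible `e` as above; slot-constant
data by abc-iut-S3's `PointDict.hullEstimateOf_BIIIe_pinned`. CONDITIONAL; nothing asserted; no side taken.
[cite: Mochizuki2012, IUTchIV Thm. 1.10 p. 22–23] [claim: Mochizuki2012, status: disputed] -/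
theorem thm110DisplayVerbatim_of_cor312_of_hullRegimeE
    (h312 : ∀ P : NFPoint, P ∈ UP → ∀ l : ℕ, l.Prime → 5 ≤ l →
      Cor22.AdmitsCore P → Cor22.CondP2 P l → Cor22.CondP5 P l → Cor22.CondP6 P l → Cor22.Cor312AtDatum P l)
    {η : ℝ} (hη : IsEtaPrm η) {P : NFPoint} (hP : P ∈ UP) {l : ℕ} (hl : l.Prime) (h5 : 5 ≤ l)
    (hcore : Cor22.AdmitsCore P) (h2 : Cor22.CondP2 P l) (hP5 : Cor22.CondP5 P l) (h6 : Cor22.CondP6 P l)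
    {e : ℕ} (he : 1 ≤ e) (he' : e ≤ Cor22.dmod P)
    (hemod : ∀ w : HeightOneSpectrum (𝓞 (IntermediateField.adjoin ℚ ({Cor22.jInv P.x} : Set P.F))),
      w.asIdeal.ramificationIdx ℤ ≤ e)
    (hregE : ∀ T : Cor22.ThetaVolumeDatumAt P l,
        (letI := T.instFieldF; letI := T.instNumberFieldF; letI := T.instAlgebraF; letI := T.instFieldK
         letI := T.instNumberFieldK; letI := T.instAlgebraK; letI := T.instFieldFbar; letI := T.instAlgebraFbar
         letI := T.instAlgebraKFbar; letI := T.instIsElliptic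
         ¬ (∀ p ∈ T.I.supportPrimes, ∀ v w : placesOver (fieldOfModuli T.E) p,
            (Summit.ABC.IUTFork.DHData.ofInput T.I).logQloc p v = (Summit.ABC.IUTFork.DHData.ofInput T.I).logQloc p w)) →
        T.HullEstimateOf
          (((l : ℝ) + 1) / 4 *
            ((1 + 12 * (Cor22.dmod P : ℝ) / l) * (P.logDiff + Cor22.logCondAvoid P {2, l})
              + 2 * Real.log l + 52
              + 20 / 3 * Real.log (((2 ^ 12 * 3 ^ 3 * 5 * e : ℕ) : ℝ) * (l : ℝ))
                * (Nat.primeCounting (2 ^ 12 * 3 ^ 3 * 5 * e * l) : ℝ)))) :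
    1 / 6 * Cor22.logQAvoid P {2, l} ≤
      (1 + 20 * (Cor22.dmod P : ℝ) / l) * (P.logDiff + Cor22.logCondAvoid P {2, l})
        + 20 * ((((2 ^ 12 * 3 ^ 3 * 5 * e : ℕ) : ℝ)) * l + η) := by
  have h7 : 7 ≤ l := seven_le_of_condP6 hP hl h5 h6
  have hne : l ≠ 5 := by omega
  obtain ⟨T⟩ := Summit.ABC.ABC.Theorems.ThetaPartII.stub_thetaData P hP l hl h5 hcore h2 hP5 h6
  have hvol : Cor22.HullVolumeAtDatum P l
      (((l : ℝ) + 1) / 4 *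
        ((1 + 12 * (Cor22.dmod P : ℝ) / l) * (P.logDiff + Cor22.logCondAvoid P {2, l})
          + 2 * Real.log l + 52
          + 20 / 3 * Real.log (((2 ^ 12 * 3 ^ 3 * 5 * e : ℕ) : ℝ) * (l : ℝ))
            * (Nat.primeCounting (2 ^ 12 * 3 ^ 3 * 5 * e * l) : ℝ))) := by
    intro T'
    letI := T'.instFieldF; letI := T'.instNumberFieldF; letI := T'.instAlgebraF; letI := T'.instFieldK
    letI := T'.instNumberFieldK; letI := T'.instAlgebraK; letI := T'.instFieldFbar; letI := T'.instAlgebraFbar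
    letI := T'.instAlgebraKFbar; letI := T'.instIsElliptic
    by_cases hc : ∀ p ∈ T'.I.supportPrimes, ∀ v w : placesOver (fieldOfModuli T'.E) p,
        (Summit.ABC.IUTFork.DHData.ofInput T'.I).logQloc p v = (Summit.ABC.IUTFork.DHData.ofInput T'.I).logQloc p w
    · exact PointDict.hullEstimateOf_BIIIe_pinned T' hP h7 he hemod hc
    · exact hregE T' hc
  refine ThetaPartIIDisplay.displayE_of_squeezeE hl h5 hne hη he he' ?_
  exact PointDict.logQAvoid_le_of_cor312AtDatum (h312 P hP l hl h5 hcore h2 hP5 h6) hvol T hP.1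

/-- **The admissible choice `e := d_mod` recovers the cell's `Cor22.Display`** (the `d*_mod` form consumed by [IUTchIV]
Cor. 2.2, p. 46 l. 1) from the verbatim display: sanity link between the two forms, reading (P). Every finite place `w` of
`F_mod` has `e(w | p) ≤ [F_mod : ℚ] = d_mod` (`ramificationIdx_fieldOfModuliPt_le_dmod`). CONDITIONAL on `h312P`; no side taken.
[cite: Mochizuki2012, IUTchIV Thm. 1.10 p. 22–23, Cor. 2.2 (ii) proof p. 46] [claim: Mochizuki2012, status: disputed] -/
theorem display_of_cor312PerImage_via_verbatim
    (h312P : ∀ P : NFPoint, P ∈ UP → ∀ l : ℕ, l.Prime → 5 ≤ l →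
      Cor22.AdmitsCore P → Cor22.CondP2 P l → Cor22.CondP5 P l → Cor22.CondP6 P l →
        Cor22.Cor312PerImageAtDatum P l)
    {η : ℝ} (hη : IsEtaPrm η) {P : NFPoint} (hP : P ∈ UP) {l : ℕ} (hl : l.Prime) (h5 : 5 ≤ l)
    (hcore : Cor22.AdmitsCore P) (h2 : Cor22.CondP2 P l) (hP5 : Cor22.CondP5 P l) (h6 : Cor22.CondP6 P l) :
    Cor22.Display P l η := by
  have h := thm110DisplayVerbatim_of_cor312PerImage h312P hη hP hl h5 hcore h2 hP5 h6 (Cor22.dmod_pos P) le_rfl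
    (Cor22.ThetaVolumeDatumAt.ramificationIdx_fieldOfModuliPt_le_dmod P)
  unfold Cor22.Display
  have hcast : (((2 ^ 12 * 3 ^ 3 * 5 * Cor22.dmod P : ℕ) : ℝ)) = 2 ^ 12 * 3 ^ 3 * 5 * (Cor22.dmod P : ℝ) := by
    push_cast; ring
  rw [hcast] at h
  exact h

end Summit.ABC.ABC.Theorems.ThetaPartII

end
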